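import Mathlib
import HarnessLib
import Summits.HubbardSuperconductivity.HubbardSuperconductivity.Theorems.FunctionFieldCertificateWindowInfraredBoundReductions
import Literature.MathematicalPhysics.QuantumLattice.HubbardTorusFlux

/-!
# Crux-strategist s1 sketch — crux `WindowInfraredBound` (stmt-HubbardSuperconductivity-1089): typed companions of STRATEGY-CENSUS.md v2

RECONSTRUCTION NOTICE. The unit `cstrat-stmt-HubbardSuperconductivity-1089-s1` was launched twice on one folder (2026-08-17T07:22:58Z).
The first instance wrote and checked (rc 0) a `Sketch.lean` with the four sections below and cites it in `STRATEGY-CENSUS.md` v2 as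
`SketchStrategistS1.lean`; the second instance overwrote `Sketch.lean` (07:34Z) with its condensate-threshold split BEFORE the first
instance published the path (07:40Z), so the file first published under this name was the threshold split (now `SketchStrategistS1b.lean`).
This file is the second instance's RECONSTRUCTION of §A–§D from the census prose (same declaration names), kernel-checked, so that every
typed claim of the canonical census is again backed by a tree file. Nothing here is filed as a route item or split (census §Decomposition /
§Strengthen: not filed, reasons there).

* §A `WibAt U δ` — the crux body at one point, tree vocabulary; `wib_iff_forall_wibAt`.
* §B order dichotomy (D-s1.1): `HasPairOrderAt`, `SubOrdered`, `SubDisordered`, glue `WindowInfraredBound_of_orderDichotomy` (PROVED).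
* §C scale split at `ε²L = 1` (D-s1.2): `WibUnder P`, `SubMesoscopic`, `SubInfrared`, glue `WindowInfraredBound_of_scaleSplit` (PROVED).
* §D `TorusFluxStiffnessFloor` (S-s1.2, typed only): uniform superfluid-weight floor of the seam-twisted torus (`fluxEnergy`).
-/

namespace Summit.HubbardSuperconductivity.HubbardSuperconductivity.Cruxes.WindowInfraredBound.StrategistS1

set_option linter.dupNamespace false

open Literature.MathematicalPhysics.QuantumLattice Literature.Probability.LatticeModels Matrix Finset
open scoped ComplexOrder ComplexConjugate
open Summit.HubbardSuperconductivity.HubbardSuperconductivity.Theses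
open Summit.HubbardSuperconductivity.HubbardSuperconductivity.Theorems

/-! ## §A The crux body at one point -/

/-- `WibAt U δ`: the body of `WindowInfraredBound` at the point `(U, δ)` (tree vocabulary of
`wib_iff_pairStructureFactor`). -/
def WibAt (U δ : ℝ) : Prop :=
  ∃ C ε₀ : ℝ, 0 ≤ C ∧ 0 < ε₀ ∧ ∃ L₀ : ℕ,
    ∀ ε ∈ Set.Ioc (0:ℝ) ε₀, ∀ (L : ℕ) [NeZero L], L₀ ≤ L → Even L →
      ∀ ψ : Fock (Orb (FermionTorus 2 L)), star ψ ⬝ᵥ ψ = 1 →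
        IsGroundStateInSector (hubbardTorus 2 L 1 U) (2 * ⌊(1 - δ) * (L : ℝ) ^ 2 / 2⌋₊) 0 ψ →
          (∑ m : TorusSite 2 L, if m ≠ 0 ∧ momentumNormSq L m ≤ ε ^ 2 then
              pairStructureFactor dWaveFormFactor L ψ m else 0) ≤ C * ε * (L : ℝ) ^ 2

/-- The crux is `∀ (U, δ), WibAt U δ` (definitional). -/
theorem wib_iff_forall_wibAt :
    FunctionFieldCertificate.WindowInfraredBound ↔ ∀ U : ℝ, 0 < U → ∀ δ ∈ Set.Ioo (0:ℝ) (1 / 2), WibAt U δ :=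
  Iff.rfl

/-! ## §B Order dichotomy (census D-s1.1) -/

/-- `HasPairOrderAt U δ`: limsup `d`-wave pair order `> 0` along the ground-state sequence at `(U, δ)` —
some `a > 0` such that for arbitrarily large even `L` some normalised sector ground state has
`S_ψ(0) ≥ a L²`. -/
def HasPairOrderAt (U δ : ℝ) : Prop :=
  ∃ a : ℝ, 0 < a ∧ ∀ L₀ : ℕ, ∃ (L : ℕ) (_ : NeZero L), L₀ ≤ L ∧ Even L ∧
    ∃ ψ : Fock (Orb (FermionTorus 2 L)), star ψ ⬝ᵥ ψ = 1 ∧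
      IsGroundStateInSector (hubbardTorus 2 L 1 U) (2 * ⌊(1 - δ) * (L : ℝ) ^ 2 / 2⌋₊) 0 ψ ∧
        a * (L : ℝ) ^ 2 ≤ pairStructureFactor dWaveFormFactor L ψ 0

/-- Ordered half: where the ground-state sequence has `d`-wave pair order, the window law holds. -/
def SubOrdered : Prop :=
  ∀ U : ℝ, 0 < U → ∀ δ ∈ Set.Ioo (0:ℝ) (1 / 2), HasPairOrderAt U δ → WibAt U δ

/-- Disordered half: where it has none, the window law holds. -/
def SubDisordered : Prop :=
  ∀ U : ℝ, 0 < U → ∀ δ ∈ Set.Ioo (0:ℝ) (1 / 2), ¬ HasPairOrderAt U δ → WibAt U δ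

/-- **Glue (kernel-checked):** the order dichotomy gives the crux (excluded middle per point). -/
theorem WindowInfraredBound_of_orderDichotomy (hO : SubOrdered) (hN : SubDisordered) :
    FunctionFieldCertificate.WindowInfraredBound := by
  rw [wib_iff_forall_wibAt]
  intro U hU δ hδ
  by_cases h : HasPairOrderAt U δ
  · exact hO U hU δ hδ h
  · exact hN U hU δ hδ h

/-! ## §C Scale split at `ε² L = 1` (census D-s1.2) -/

/-- `WibUnder P`: the crux restricted to the window radii / volumes `(ε, L)` with `P ε L`. -/
def WibUnder (P : ℝ → ℕ → Prop) : Prop :=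
  ∀ U : ℝ, 0 < U → ∀ δ ∈ Set.Ioo (0:ℝ) (1 / 2), ∃ C ε₀ : ℝ, 0 ≤ C ∧ 0 < ε₀ ∧ ∃ L₀ : ℕ,
    ∀ ε ∈ Set.Ioc (0:ℝ) ε₀, ∀ (L : ℕ) [NeZero L], L₀ ≤ L → Even L → P ε L →
      ∀ ψ : Fock (Orb (FermionTorus 2 L)), star ψ ⬝ᵥ ψ = 1 →
        IsGroundStateInSector (hubbardTorus 2 L 1 U) (2 * ⌊(1 - δ) * (L : ℝ) ^ 2 / 2⌋₊) 0 ψ →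
          (∑ m : TorusSite 2 L, if m ≠ 0 ∧ momentumNormSq L m ≤ ε ^ 2 then
              pairStructureFactor dWaveFormFactor L ψ m else 0) ≤ C * ε * (L : ℝ) ^ 2

/-- Mesoscopic radii `ε ≥ L^{-1/2}` (at least `≈ L/4π` window modes). -/
def SubMesoscopic : Prop := WibUnder (fun ε L => 1 ≤ ε ^ 2 * (L : ℝ))

/-- Infrared radii `ε < L^{-1/2}` (the bottom `≈ L/4π` modes: the tower-of-states regime). -/
def SubInfrared : Prop := WibUnder (fun ε L => ε ^ 2 * (L : ℝ) < 1)

/-- **Glue (kernel-checked):** the scale split gives the crux (`max C`, `min ε₀`, `max L₀`, case on `1 ≤ ε²L`). -/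
theorem WindowInfraredBound_of_scaleSplit (hM : SubMesoscopic) (hI : SubInfrared) :
    FunctionFieldCertificate.WindowInfraredBound := by
  rw [wib_iff_pairStructureFactor]
  intro U hU δ hδ
  obtain ⟨C₁, ε₁, hC₁, hε₁, L₁, h₁⟩ := hM U hU δ hδ
  obtain ⟨C₂, ε₂, hC₂, hε₂, L₂, h₂⟩ := hI U hU δ hδ
  refine ⟨max C₁ C₂, min ε₁ ε₂, le_max_of_le_left hC₁, lt_min hε₁ hε₂, max L₁ L₂, ?_⟩
  intro ε hε L _ hL hEven ψ hψ hGS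
  have hε0 : 0 ≤ ε := hε.1.le
  have hL2 : 0 ≤ (L : ℝ) ^ 2 := sq_nonneg _
  by_cases h : 1 ≤ ε ^ 2 * (L : ℝ)
  · calc (∑ m : TorusSite 2 L, if m ≠ 0 ∧ momentumNormSq L m ≤ ε ^ 2 then
              pairStructureFactor dWaveFormFactor L ψ m else 0)
          ≤ C₁ * ε * (L : ℝ) ^ 2 :=
            h₁ ε ⟨hε.1, hε.2.trans (min_le_left _ _)⟩ L (le_of_max_le_left hL) hEven h ψ hψ hGS
      _ ≤ max C₁ C₂ * ε * (L : ℝ) ^ 2 := by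
            apply mul_le_mul_of_nonneg_right _ hL2
            exact mul_le_mul_of_nonneg_right (le_max_left _ _) hε0
  · have h' : ε ^ 2 * (L : ℝ) < 1 := lt_of_not_ge h
    calc (∑ m : TorusSite 2 L, if m ≠ 0 ∧ momentumNormSq L m ≤ ε ^ 2 then
              pairStructureFactor dWaveFormFactor L ψ m else 0)
          ≤ C₂ * ε * (L : ℝ) ^ 2 :=
            h₂ ε ⟨hε.1, hε.2.trans (min_le_right _ _)⟩ L (le_of_max_le_right hL) hEven h' ψ hψ hGS
      _ ≤ max C₁ C₂ * ε * (L : ℝ) ^ 2 := by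
            apply mul_le_mul_of_nonneg_right _ hL2
            exact mul_le_mul_of_nonneg_right (le_max_right _ _) hε0

/-- Converse bookkeeping: the crux gives every restriction (so the scale split loses nothing). -/
theorem wibUnder_of_windowInfraredBound (P : ℝ → ℕ → Prop)
    (h : FunctionFieldCertificate.WindowInfraredBound) : WibUnder P := by
  rw [wib_iff_pairStructureFactor] at h
  intro U hU δ hδ
  obtain ⟨C, ε₀, hC, hε₀, L₀, h⟩ := h U hU δ hδ
  exact ⟨C, ε₀, hC, hε₀, L₀, fun ε hε L _ hL hEven _ ψ hψ hGS => h ε hε L hL hEven ψ hψ hGS⟩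

/-! ## §D Uniform superfluid-weight floor (census S-s1.2; typed only, no claim) -/

/-- `TorusFluxStiffnessFloor`: at every `(U, δ)` a uniform floor `ρ θ² ≤ E_L(θ) − E_L(0)` for the sector
ground energy `fluxEnergy L U δ θ` of the seam-twisted torus `hubbardTorusFlux L U θ`, `|θ| ≤ π/2` (pairs see
`2θ`: half period), eventually in even `L` — Kohn / Byers–Yang / Scalapino–White–Zhang superfluid weight `> 0`.
Typed to make census S-s1.2 precise; NOT asserted and not filed (believed false at the stripe points of the pure
model; reaches the crux only through the Josephson relation). -/
def TorusFluxStiffnessFloor : Prop :=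
  ∀ U : ℝ, 0 < U → ∀ δ ∈ Set.Ioo (0:ℝ) (1 / 2), ∃ ρ : ℝ, 0 < ρ ∧ ∃ L₀ : ℕ,
    ∀ (L : ℕ) [NeZero L], L₀ ≤ L → Even L →
      ∀ θ ∈ Set.Icc (-(Real.pi / 2)) (Real.pi / 2),
        ρ * θ ^ 2 ≤ fluxEnergy L U δ θ - fluxEnergy L U δ 0

end Summit.HubbardSuperconductivity.HubbardSuperconductivity.Cruxes.WindowInfraredBound.StrategistS1
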